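import Literature.Analysis.FluidPDE.KNSSThm52SliceBridge
import Literature.Analysis.FluidPDE.AncientMildDriftOrthogonal
import Literature.Analysis.FunctionSpaces.MeasurableGramKernel
import HarnessLib

/-!
# Gauge fixing in the duality-form class of bounded ancient mild solutions

Analysis/FluidPDE support file (all results proved; no definitions, no named facts). It settles
the class question left open by the tree's rendering `LiouvilleConjectureNS` of the Liouville
conjecture (L) of Koch–Nadirashvili–Seregin–Šverák (crux `TypeIliouvilleL`, item
stmt-NavierStokesRegularity-10661): the duality-form class `IsBoundedAncientMildSolution` asks only
for measurable *slices* and contains, besides print's bounded weak solutions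
`u ∈ L^∞(E × (−∞, 0))`, their images under a possibly NON-measurable spatially constant drift
`b(t)` (KNSS 2009, §1 p. 3, "the notion of weak solution does allow the parasitic solutions";
`isBoundedAncientMildSolution_timeConst`). The main theorem shows that this is the only difference:

* `IsBoundedAncientMildSolution.exists_stronglyMeasurable_gauge` (**gauge fixing**, any finite
  dimension, any `ν > 0`): every bounded ancient mild solution `u` in duality form with measurable
  slices agrees, slice by slice a.e. and **modulo spatial constants `d(t)`**, with a bounded ancient
  mild solution `ũ` of the same class which is **jointly strongly measurable** — hence a bounded
  weak solution in the sense of KNSS, `IsBoundedAncientMildSolution.isBoundedWeakNSSolutionOn`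
  (`…exists_isBoundedWeakNSSolutionOn_gauge`).
* `liouville_duality_iff_stronglyMeasurable`: consequently the slice-wise Liouville statement for
  the whole duality-form class is EQUIVALENT to the same statement for its jointly measurable
  members: the tree's (L) is print's (L).

## The proof (generalising `knss_axisymmetric_no_swirl_of_KNSS2009`, where the drift was axial)

(1) Subtract the average `c(t) = ∫ g u(t)` against a bump of unit mass: `u(t) = w(t) + c(t)` a.e.
with `w` jointly measurable and bounded (`exists_modification_sub_average`). (2) The nonlinear
time integrand of the identity ending at `q` splits as `N(τ) + ⟪c(τ), m^{q,φ}(τ)⟫` with `N` and the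
vector `m^{q,φ}(τ)` (Riesz vector of `e ↦ ∫⟪w τ, ∂ₑ e^{ν(q−τ)Δ}φ⟫`) measurable in `τ`
(`integral_inner_convect_heatTest_add_const_vec`). (3) At an honest rational final time `q`
(non-constant slice) the integrand is honestly integrable
(`intervalIntegrable_nonlinear_of_not_ae_const`), so the *activated pairings*
`𝟙_{τ<q} ⟪c τ, m^{q,φₖ}(τ)⟫`, `φₖ` an `L¹`-dense family of solenoidal tests, are a.e. measurable.
(4) The weighted Gram operator `A(τ)` of the countable family `m^{q,φₖ}(τ)`
(`exists_measurable_gram_operator`) is measurable, symmetric, nonnegative, and `A(τ)c(τ)` is a.e.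
measurable; the resolvent selection (`exists_measurable_kernel_gauge`) produces a MEASURABLE `c̄`
with `A(τ)(c̄(τ) − c(τ)) = 0` a.e., i.e. `d = c̄ − c` is orthogonal to every active `m^{q,φₖ}(τ)`.
(5) Orthogonality propagates to every directional pairing `∫⟪w τ, ∂_{d(τ)} e^{νσΔ}φ⟫`: where the
honest rationals accumulate at `τ⁺`, by density, the limit `σ → 0⁺` and the directional invariance
of the slice (`integral_inner_fderiv_heatTest_eq_zero_of_dense`,
`integral_inner_fderiv_eq_zero_of_tendsto`,
`ae_eq_comp_add_smul_of_forall_integral_inner_fderiv_eq_zero`,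
`integral_inner_fderiv_heatTest_apply_eq_zero_of_ae_invariant`); elsewhere the a.e.-constant
slices accumulate at `τ⁺` and `w τ` is itself a.e. constant. (6) The generalised drift lemma
(`IsBoundedAncientMildSolution.add_timeConst_of_ae_orthogonal`) puts `ũ = w + c̄ = (w + c) + d` in
the class; it is jointly measurable.

## References

* G. Koch, N. Nadirashvili, G. Seregin, V. Šverák, *Liouville theorems for the Navier–Stokes
  equations and applications*, Acta Math. 203 (2009) 83–105 = arXiv:0709.3599, §1 p. 3 (parasitic
  solutions `u(x,t) = b(t)`), §3 p. 7 and §4 (i)–(ii) p. 8 (bounded weak solutions; `b` bounded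
  measurable). [KochNadirashviliSereginSverak2009]
* E. B. Fabes, B. F. Jones, N. M. Rivière, Arch. Rational Mech. Anal. 45 (1972), Thm. 2.1 (the
  duality identity). [FabesJonesRiviere1972]
-/

noncomputable section

open MeasureTheory Set Function Filter Topology TopologicalSpace InnerProductSpace
open scoped RealInnerProductSpace NNReal ENNReal ContDiff

namespace Literature.Analysis.FluidPDE

variable {E : Type*} [NormedAddCommGroup E] [InnerProductSpace ℝ E] [FiniteDimensional ℝ E]
  [MeasurableSpace E] [BorelSpace E]

/-! ### The Riesz vector of the directional pairings -/

section Riesz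

/-- **The directional pairings are the inner products with a Riesz vector**: for a bounded
measurable `W` and a field of operators `L` whose frame components `x ↦ L x (b i)` are integrable,
`∫⟪W x, L x v⟫ = ⟪v, ∑ᵢ (∫⟪W x, L x bᵢ⟫) bᵢ⟫` over the standard orthonormal frame `b`. [folklore] -/
theorem integral_inner_clm_apply_eq_inner_sum {W : E → E} (hW : AEStronglyMeasurable W volume)
    {M : ℝ} (hM : ∀ x, ‖W x‖ ≤ M) {L : E → E →L[ℝ] E}
    (hL : ∀ i, Integrable (fun x => L x (stdOrthonormalBasis ℝ E i)) volume) (v : E) :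
    ∫ x, ⟪W x, L x v⟫ =
      ⟪v, ∑ i, (∫ x, ⟪W x, L x (stdOrthonormalBasis ℝ E i)⟫) • stdOrthonormalBasis ℝ E i⟫ := by
  set b := stdOrthonormalBasis ℝ E with hb
  have hv : v = ∑ i, ⟪b i, v⟫ • b i := (b.sum_repr' v).symm
  have hint : ∀ i, Integrable (fun x => ⟪W x, L x (b i)⟫) volume := fun i =>
    integrable_inner_of_aestronglyMeasurable_of_norm_le hW hM (hL i)
  calc ∫ x, ⟪W x, L x v⟫ = ∫ x, ∑ i, ⟪b i, v⟫ * ⟪W x, L x (b i)⟫ := by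
        refine integral_congr_ae (Eventually.of_forall fun x => ?_)
        conv_lhs => rw [hv]
        simp only [map_sum, map_smul, inner_sum, real_inner_smul_right]
    _ = ∑ i, ⟪b i, v⟫ * ∫ x, ⟪W x, L x (b i)⟫ := by
        rw [integral_finsetSum _ fun i _ => (hint i).const_mul _]
        exact Finset.sum_congr rfl fun i _ => integral_const_mul _ _
    _ = ⟪v, ∑ i, (∫ x, ⟪W x, L x (b i)⟫) • b i⟫ := by
        simp only [inner_sum, real_inner_smul_right]
        exact Finset.sum_congr rfl fun i _ => by rw [real_inner_comm (b i) v]; ring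

/-- The `L¹` norm of a frame component of the gradient of a caloric test field is at most that of
the test field itself (`∂ₑ e^{sΔ}φ = e^{sΔ}∂ₑφ` and the `L¹` contraction). [folklore] -/
theorem integral_norm_fderiv_heatTest_apply_le {φ : E → E}
    (hφ : FunctionSpaces.IsTestFunctionOn (⊤ : Opens E) φ) (ν σ : ℝ) (e : E) :
    ∫ x, ‖fderiv ℝ (heatTest ν φ σ) x e‖ ≤ ∫ x, ‖fderiv ℝ φ x e‖ := by
  have hφ1 : ContDiff ℝ 1 φ := hφ.contDiff.of_le (by exact_mod_cast le_top)
  have hgc : Continuous fun z => fderiv ℝ φ z e := (hφ1.continuous_fderiv one_ne_zero).clm_apply continuous_const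
  have hgi : Integrable (fun z => fderiv ℝ φ z e) volume :=
    hgc.integrable_of_hasCompactSupport (hφ.hasCompactSupport.fderiv_apply (𝕜 := ℝ) e)
  have heq : (fun x => ‖fderiv ℝ (heatTest ν φ σ) x e‖) = fun x => ‖heatFlow (fun z => fderiv ℝ φ z e) (ν * σ) x‖ :=
    funext fun x => by rw [show heatTest ν φ σ = heatFlow φ (ν * σ) from rfl, fderiv_heatFlow_apply hφ1 hφ.hasCompactSupport]
  rw [heq]
  exact integral_norm_heatFlow_le hgi _

end Riesz

/-! ### Gauge fixing -/

section Gauge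

variable {ν : ℝ} {u : ℝ → E → E}

/-- **Gauge fixing in the duality-form class.** Let `u` be a bounded ancient mild solution
(`0 < ν`, duality form) with a.e.-strongly measurable slices. Then there are a bounded ancient mild
solution `ũ` of the same class which is **jointly strongly measurable** on `ℝ × E`, and spatial
constants `d(t)`, bounded on `t < 0`, with `ũ(t) = u(t) + d(t)` a.e. for every `t < 0`. See the
module docstring for the proof (average subtraction, the honest regime, the measurable Gram
operator of the activated directional pairings, resolvent gauge selection, directional invariance,
and the generalised drift lemma). This is the precise sense in which the tree's slice-wise class
differs from print's `L^∞(E × (−∞, 0))` only by the parasitic drift of KNSS 2009, §1 p. 3.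
[cite: KochNadirashviliSereginSverak2009, §1 p. 3 (parasitic solutions u(x,t) = b(t)); §3 p. 7 (b bounded measurable for L^∞ weak solutions)] -/
theorem IsBoundedAncientMildSolution.exists_stronglyMeasurable_gauge
    (hu : IsBoundedAncientMildSolution ν u) (hν : 0 < ν)
    (hmeas : ∀ t < 0, AEStronglyMeasurable (u t) volume) :
    ∃ (ũ : ℝ → E → E) (d : ℝ → E),
      IsBoundedAncientMildSolution ν ũ ∧ StronglyMeasurable (uncurry ũ) ∧
      (∃ D : ℝ, ∀ t < 0, ‖d t‖ ≤ D) ∧ ∀ t < 0, ũ t =ᵐ[volume] fun x => u t x + d t := by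
  classical
  obtain ⟨M, hM'⟩ := hu.2
  have hM : ∀ t < 0, ∀ x, ‖u t x‖ ≤ M := fun t ht x => hM' t ht x
  have hM0 : 0 ≤ M := (norm_nonneg _).trans (hM (-1) (by norm_num) 0)
  -- (i) a bump of unit mass and the averages `c t`
  set ρ : ContDiffBump (0 : E) := ⟨1, 2, one_pos, one_lt_two⟩ with hρ_def
  set g : E → ℝ := ρ.normed volume with hg_def
  have hg : FunctionSpaces.IsTestFunctionOn (⊤ : Opens E) g := FunctionSpaces.isTestFunctionOn_normed ρ
  have hgc : Continuous g := hg.contDiff.continuous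
  have hgi : Integrable g := hgc.integrable_of_hasCompactSupport hg.hasCompactSupport
  have hg0 : ∀ y, 0 ≤ g y := fun y => ρ.nonneg_normed y
  have hg1 : ∫ y, g y = 1 := ρ.integral_normed
  set c : ℝ → E := fun t => ∫ y, g y • u t y with hc_def
  have hcb : ∀ t < 0, ‖c t‖ ≤ M := by
    intro t ht
    calc ‖c t‖ ≤ ∫ y, ‖g y‖ * M := norm_integral_le_of_norm_le (hgi.norm.mul_const M)
          (Eventually.of_forall fun y => by
            rw [norm_smul]
            exact mul_le_mul_of_nonneg_left (hM t ht y) (norm_nonneg _))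
      _ = M := by
          rw [integral_mul_const]
          have : ∫ y, ‖g y‖ = 1 := by
            rw [← hg1]
            exact integral_congr_ae (Eventually.of_forall fun y => Real.norm_of_nonneg (hg0 y))
          rw [this, one_mul]
  -- (ii) the jointly measurable modification `w`, `u t = w t + c t` a.e.
  obtain ⟨w, hw, ⟨B, hwB⟩, hwu⟩ := hu.exists_modification_sub_average hν hmeas hgc hg.hasCompactSupport hg1
  have huw : ∀ t < 0, u t =ᵐ[volume] fun x => w t x + c t := fun t ht => by
    filter_upwards [hwu t ht] with x hx
    rw [hx, sub_add_cancel]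
  have hwm : ∀ t, AEStronglyMeasurable (w t) volume := fun t =>
    (hw.comp_measurable measurable_prodMk_left).aestronglyMeasurable
  have hwdiv : ∀ t < 0, IsWeaklyDivFree (w t) := fun t ht =>
    isWeaklyDivFree_of_ae_eq_add_const (hu.1.1 t ht) (hmeas t ht) (hM t ht) (-(c t))
      ((hwu t ht).trans (Eventually.of_forall fun x => by
        show u t x - c t = u t x + -c t
        rw [sub_eq_add_neg]))
  -- (iii) `u' = w + c`, a.e. equal to `u` slice-wise, is in the class
  set u' : ℝ → E → E := fun t x => w t x + c t with hu'_def
  have hu'u : ∀ t < 0, u' t =ᵐ[volume] u t := fun t ht => (huw t ht).symm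
  have hu'M : ∀ t < 0, ∀ x, ‖u' t x‖ ≤ B + M := fun t ht x =>
    (norm_add_le _ _).trans (add_le_add (hwB t x) (hcb t ht))
  have hu'sol : IsBoundedAncientMildSolution ν u' := hu.congr_ae_slice hu'u ⟨B + M, fun t ht x => hu'M t ht x⟩
  have hu'meas : ∀ t < 0, AEStronglyMeasurable (u' t) volume := fun t _ => (hwm t).add aestronglyMeasurable_const
  -- (iv) the Riesz vectors of the directional pairings
  set bs := stdOrthonormalBasis ℝ E with hbs
  set mvec : ℝ → (E → E) → ℝ → E := fun q φ τ =>
    ∑ i, (∫ x, ⟪w τ x, fderiv ℝ (heatTest ν φ (q - τ)) x (bs i)⟫) • bs i with hmvec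
  have hDi : ∀ {φ : E → E}, FunctionSpaces.IsTestFunctionOn (⊤ : Opens E) φ → ∀ (σ : ℝ) (e : E),
      Integrable (fun x => fderiv ℝ (heatTest ν φ σ) x e) volume := by
    intro φ hφ σ e
    have hφ1 : ContDiff ℝ 1 φ := hφ.contDiff.of_le (by exact_mod_cast le_top)
    have hDc : Continuous fun z => fderiv ℝ φ z e := (hφ1.continuous_fderiv one_ne_zero).clm_apply continuous_const
    have : Integrable (heatFlow (fun z => fderiv ℝ φ z e) (ν * σ)) :=
      integrable_heatFlow (hDc.integrable_of_hasCompactSupport (hφ.hasCompactSupport.fderiv_apply (𝕜 := ℝ) e)) _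
    exact this.congr (Eventually.of_forall fun x => (fderiv_heatFlow_apply hφ1 hφ.hasCompactSupport _ x e).symm)
  have hmvec_inner : ∀ {φ : E → E}, FunctionSpaces.IsTestFunctionOn (⊤ : Opens E) φ → ∀ (q τ : ℝ) (v : E),
      ∫ x, ⟪w τ x, fderiv ℝ (heatTest ν φ (q - τ)) x v⟫ = ⟪v, mvec q φ τ⟫ := by
    intro φ hφ q τ v
    exact integral_inner_clm_apply_eq_inner_sum (hwm τ) (hwB τ) (fun i => hDi hφ _ _) v
  -- (v) a countable dense family of solenoidal tests; the honest set
  obtain ⟨φs, hφs, hdense⟩ := exists_seq_isDivFree_dense (E := E)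
  set Hset : Set ℝ := {r | r < 0 ∧ ∀ κ : E, ¬ (u r =ᵐ[volume] fun _ => κ)} with hHset
  -- an enumeration of the rationals
  obtain ⟨qseq, hqseq⟩ := exists_surjective_nat ℚ
  set qr : ℕ → ℝ := fun j => ((qseq j : ℚ) : ℝ) with hqr
  -- the countable family `m n`, its measurability and bounds
  set m : ℕ → ℝ → E := fun n τ => mvec (qr (Nat.unpair n).1) (φs (Nat.unpair n).2) τ with hm_def
  have hm_meas : ∀ n, Measurable (m n) := by
    intro n
    refine Finset.measurable_sum _ fun i _ => ?_
    exact (measurable_integral_inner_fderiv_heatTest_apply hw (hφs _).1 ν _ (bs i)).smul_const _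
  set Dk : ℕ → ℝ := fun k => ∑ i, B * ∫ x, ‖fderiv ℝ (φs k) x (bs i)‖ with hDk
  have hmD : ∀ n τ, ‖m n τ‖ ≤ Dk (Nat.unpair n).2 := by
    intro n τ
    set k := (Nat.unpair n).2
    set q := qr (Nat.unpair n).1
    have hB0 : 0 ≤ B := (norm_nonneg _).trans (hwB 0 0)
    calc ‖m n τ‖ ≤ ∑ i, ‖(∫ x, ⟪w τ x, fderiv ℝ (heatTest ν (φs k) (q - τ)) x (bs i)⟫) • bs i‖ :=
          norm_sum_le _ _
      _ ≤ ∑ i, B * ∫ x, ‖fderiv ℝ (φs k) x (bs i)‖ := by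
          refine Finset.sum_le_sum fun i _ => ?_
          rw [norm_smul, bs.norm_eq_one i, mul_one]
          calc ‖∫ x, ⟪w τ x, fderiv ℝ (heatTest ν (φs k) (q - τ)) x (bs i)⟫‖
              ≤ ∫ x, B * ‖fderiv ℝ (heatTest ν (φs k) (q - τ)) x (bs i)‖ :=
                norm_integral_le_of_norm_le ((hDi (hφs k).1 _ _).norm.const_mul B)
                  (Eventually.of_forall fun x => (norm_inner_le_norm _ _).trans
                    (mul_le_mul_of_nonneg_right (hwB τ x) (norm_nonneg _)))
            _ = B * ∫ x, ‖fderiv ℝ (heatTest ν (φs k) (q - τ)) x (bs i)‖ := integral_const_mul _ _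
            _ ≤ B * ∫ x, ‖fderiv ℝ (φs k) x (bs i)‖ :=
                mul_le_mul_of_nonneg_left (integral_norm_fderiv_heatTest_apply_le (hφs k).1 ν _ _) hB0
  -- the activity sets: `τ < q`, `q` an honest rational
  set S : ℕ → Set ℝ := fun n => if qr (Nat.unpair n).1 ∈ Hset then Iio (qr (Nat.unpair n).1) else ∅ with hS_def
  have hS : ∀ n, MeasurableSet (S n) := fun n => by
    simp only [hS_def]
    split_ifs
    · exact measurableSet_Iio
    · exact MeasurableSet.empty
  -- (vi) the splitting of the nonlinear integrand and the a.e. measurability of the activated pairings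
  have hact : ∀ n, AEStronglyMeasurable ((S n).indicator fun τ => ⟪c τ, m n τ⟫) volume := by
    intro n
    set j := (Nat.unpair n).1
    set k := (Nat.unpair n).2
    by_cases hH : qr j ∈ Hset
    · have hSn : S n = Iio (qr j) := by simp only [hS_def]; rw [if_pos hH]
      rw [hSn, aestronglyMeasurable_indicator_iff measurableSet_Iio]
      have hq0 : qr j < 0 := hH.1
      set qq : ℝ := qr j with hqq
      -- the three functions of `τ`
      set Gf : ℝ → ℝ := fun τ => ∫ x, ⟪u τ x, convect (u τ) (heatTest ν (φs k) (qq - τ)) x⟫ with hGf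
      set Nf : ℝ → ℝ := fun τ => ∫ x, ⟪w τ x, fderiv ℝ (heatTest ν (φs k) (qq - τ)) x (w τ x)⟫ with hNf
      have hNm : Measurable Nf := measurable_integral_inner_fderiv_heatTest_self hw (hφs k).1 ν qq
      have hsplit : ∀ τ < 0, Gf τ = Nf τ + ⟪c τ, m n τ⟫ := by
        intro τ hτ
        have e1 : Gf τ = ∫ x, ⟪u' τ x, convect (u' τ) (heatTest ν (φs k) (qq - τ)) x⟫ :=
          integral_inner_convect_heatTest_congr_ae (huw τ hτ) _
        rw [e1]
        have e2 := integral_inner_convect_heatTest_add_const_vec (hwm τ) (hwB τ) (hwdiv τ hτ) (c τ) (hφs k).1 ν (qq - τ)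
        simp only [hu'_def] at e2 ⊢
        rw [e2, hmvec_inner (hφs k).1]
        rfl
      have hGint : ∀ s < qq, IntervalIntegrable Gf volume s qq := fun s hs =>
        hu.intervalIntegrable_nonlinear_of_not_ae_const hν hmeas hq0 hH.2 hs (hφs k).1 (hφs k).2
      have hcm_s : ∀ s < qq, AEMeasurable (fun τ => ⟪c τ, m n τ⟫) (volume.restrict (Ioo s qq)) := by
        intro s hs
        have hGae : AEMeasurable Gf (volume.restrict (Ioo s qq)) :=
          ((hGint s hs).def'.mono_set (by rw [uIoc_of_le hs.le]; exact Ioo_subset_Ioc_self)).aestronglyMeasurable.aemeasurable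
        refine (hGae.sub hNm.aemeasurable).congr ?_
        refine (ae_restrict_mem measurableSet_Ioo).mono fun τ hτ => ?_
        have hτ0 : τ < 0 := hτ.2.trans hq0
        show Gf τ - Nf τ = ⟪c τ, m n τ⟫
        rw [hsplit τ hτ0]
        ring
      have hcm : AEMeasurable (fun τ => ⟪c τ, m n τ⟫) (volume.restrict (Iio qq)) := by
        have hcover : Iio qq = ⋃ N : ℕ, Ioo (qq - ((N : ℝ) + 1)) qq := by
          ext τ
          simp only [mem_Iio, mem_iUnion, mem_Ioo]
          constructor
          · intro hτ
            obtain ⟨N, hN⟩ := exists_nat_gt (qq - τ)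
            exact ⟨N, by linarith, hτ⟩
          · rintro ⟨N, -, hN2⟩
            exact hN2
        rw [hcover]
        exact aemeasurable_iUnion_iff.2 fun N => hcm_s _ (by linarith)
      exact hcm.aestronglyMeasurable
    · have hSn : S n = ∅ := by simp only [hS_def]; rw [if_neg hH]
      rw [hSn, indicator_empty]
      exact aestronglyMeasurable_zero
  -- (vii) the Gram operator and the measurable gauge
  obtain ⟨A, hAm, hAsymm, hApos, hAker, hAc⟩ :=
    FunctionSpaces.exists_measurable_gram_operator (volume : Measure ℝ) hm_meas hmD hS
  have hy : AEStronglyMeasurable (fun τ => A τ (c τ)) volume := hAc c hact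
  set yh : ℝ → E := hy.mk _ with hyh
  have hyhm : Measurable yh := hy.stronglyMeasurable_mk.measurable
  have hyy : (fun τ => A τ (c τ)) =ᵐ[volume] yh := hy.ae_eq_mk
  obtain ⟨cg, hcgm, hcg⟩ := FunctionSpaces.exists_measurable_kernel_gauge hAm hAsymm hApos hyhm
  -- the clipped, bounded, measurable drift `ct`
  set ct : ℝ → E := fun τ => if ‖cg τ‖ ≤ M then cg τ else 0 with hct_def
  have hctm : Measurable ct := Measurable.ite (measurableSet_le hcgm.norm measurable_const) hcgm measurable_const
  have hctb : ∀ τ, ‖ct τ‖ ≤ M := fun τ => by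
    simp only [hct_def]
    split_ifs with h
    · exact h
    · rw [norm_zero]; exact hM0
  -- the good set: `A τ (ct τ - c τ) = 0`
  set d : ℝ → E := fun τ => ct τ - c τ with hd_def
  have hdb : ∀ t < 0, ‖d t‖ ≤ M + M := fun t ht =>
    (norm_sub_le _ _).trans (add_le_add (hctb t) (hcb t ht))
  have hgood : ∀ᵐ τ ∂(volume : Measure ℝ), τ < 0 → A τ (d τ) = 0 := by
    filter_upwards [hyy] with τ hτy hτ0
    obtain ⟨hk, hnorm⟩ := hcg τ (c τ) (by rw [← hτy])
    have hct_eq : ct τ = cg τ := by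
      simp only [hct_def]
      rw [if_pos (hnorm.trans (hcb τ hτ0))]
    show A τ (ct τ - c τ) = 0
    rw [map_sub, hct_eq, hk, sub_self]
  -- orthogonality to the active Riesz vectors on the good set
  have horthm : ∀ τ, A τ (d τ) = 0 → ∀ j k, qr j ∈ Hset → τ < qr j →
      ∫ x, ⟪w τ x, fderiv ℝ (heatTest ν (φs k) (qr j - τ)) x (d τ)⟫ = 0 := by
    intro τ hτ j k hH hτq
    have hmem : τ ∈ S (Nat.pair j k) := by
      simp only [hS_def, Nat.unpair_pair]
      rw [if_pos hH]
      exact hτq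
    have h := hAker τ (d τ) hτ (Nat.pair j k) hmem
    rw [hmvec_inner (hφs k).1, real_inner_comm]
    simpa only [hm_def, Nat.unpair_pair] using h
  -- (viii) orthogonality of `d τ` to EVERY directional pairing, for a.e. `τ < 0`
  have horth : ∀ᵐ τ ∂((volume : Measure ℝ).restrict (Iio 0)), ∀ t : ℝ, ∀ φ : E → E,
      FunctionSpaces.IsTestFunctionOn (⊤ : Opens E) φ → VectorCalculus.IsDivFree φ →
        ∫ x, ⟪u' τ x, fderiv ℝ (heatTest ν φ (t - τ)) x (d τ)⟫ = 0 := by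
    have hgood' := (ae_restrict_iff' (measurableSet_Iio : MeasurableSet (Iio (0 : ℝ)))).2
      (hgood.mono fun τ h hτ => h hτ)
    filter_upwards [hgood', ae_restrict_mem measurableSet_Iio] with τ hAτ hτ0
    have hτ : τ < 0 := hτ0
    -- reduce to the pairing of `w τ`
    have hred : ∀ (ψ : E → E), FunctionSpaces.IsTestFunctionOn (⊤ : Opens E) ψ → ∀ σ : ℝ,
        ∫ x, ⟪u' τ x, fderiv ℝ (heatTest ν ψ σ) x (d τ)⟫ = ∫ x, ⟪w τ x, fderiv ℝ (heatTest ν ψ σ) x (d τ)⟫ := by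
      intro ψ hψ σ
      have hψ1 : ContDiff ℝ 1 ψ := hψ.contDiff.of_le (by exact_mod_cast le_top)
      have i1 : Integrable fun x => ⟪w τ x, fderiv ℝ (heatTest ν ψ σ) x (d τ)⟫ :=
        integrable_inner_of_aestronglyMeasurable_of_norm_le (hwm τ) (hwB τ) (hDi hψ σ (d τ))
      have i2 : Integrable fun x => ⟪c τ, fderiv ℝ (heatTest ν ψ σ) x (d τ)⟫ := (hDi hψ σ (d τ)).const_inner _
      have h0 : ∫ x, ⟪c τ, fderiv ℝ (heatTest ν ψ σ) x (d τ)⟫ = 0 :=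
        integral_inner_const_fderiv_heatFlow_eq_zero hψ1 hψ.hasCompactSupport (ν * σ) (c τ) (d τ)
      calc ∫ x, ⟪u' τ x, fderiv ℝ (heatTest ν ψ σ) x (d τ)⟫
          = ∫ x, (⟪w τ x, fderiv ℝ (heatTest ν ψ σ) x (d τ)⟫ + ⟪c τ, fderiv ℝ (heatTest ν ψ σ) x (d τ)⟫) :=
            integral_congr_ae (Eventually.of_forall fun x => by simp only [hu'_def, inner_add_left])
        _ = ∫ x, ⟪w τ x, fderiv ℝ (heatTest ν ψ σ) x (d τ)⟫ := by rw [integral_add i1 i2, h0, add_zero]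
    -- the pairing of `w τ` vanishes
    have hw0 : ∀ (ψ : E → E), FunctionSpaces.IsTestFunctionOn (⊤ : Opens E) ψ → ∀ σ : ℝ,
        ∫ x, ⟪w τ x, fderiv ℝ (heatTest ν ψ σ) x (d τ)⟫ = 0 := by
      by_cases hacc : ∀ ε > (0 : ℝ), ∃ j : ℕ, qr j ∈ Hset ∧ τ < qr j ∧ qr j < τ + ε
      · -- honest rationals accumulate at `τ⁺`: invariance of `w τ` along `d τ`
        choose jn hjH hτj hjε using fun n : ℕ => hacc (1 / ((n : ℝ) + 1)) (by positivity)
        have hσpos : ∀ n, 0 < qr (jn n) - τ := fun n => sub_pos.2 (hτj n)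
        have hσ : Tendsto (fun n => qr (jn n) - τ) atTop (𝓝 0) := by
          refine squeeze_zero (fun n => (hσpos n).le) (fun n => ?_) tendsto_one_div_add_atTop_nhds_zero_nat
          linarith [hjε n]
        have hzero : ∀ n k, ∫ x, ⟪w τ x, fderiv ℝ (heatTest ν (φs k) (qr (jn n) - τ)) x (d τ)⟫ = 0 :=
          fun n k => horthm τ hAτ (jn n) k (hjH n) (hτj n)
        have hall : ∀ (φ : E → E), FunctionSpaces.IsTestFunctionOn (⊤ : Opens E) φ → VectorCalculus.IsDivFree φ →
            ∫ x, ⟪w τ x, fderiv ℝ φ x (d τ)⟫ = 0 := by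
          intro φ hφ hdivφ
          have hn : ∀ n, ∫ x, ⟪w τ x, fderiv ℝ (heatTest ν φ (qr (jn n) - τ)) x (d τ)⟫ = 0 := fun n =>
            integral_inner_fderiv_heatTest_eq_zero_of_dense (hwm τ) (hwB τ) hφs hdense
              (mul_pos hν (hσpos n)) (hzero n) hφ hdivφ
          exact integral_inner_fderiv_eq_zero_of_tendsto (hwm τ) (hwB τ) hν hσpos hσ hφ hn
        have hinv : ∀ h : ℝ, (fun x => w τ (x + h • d τ)) =ᵐ[volume] w τ :=
          ae_eq_comp_add_smul_of_forall_integral_inner_fderiv_eq_zero (hwm τ) (hwB τ) (hwdiv τ hτ) hall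
        intro ψ hψ σ
        exact integral_inner_fderiv_heatTest_apply_eq_zero_of_ae_invariant (hwm τ) (hwB τ) hinv hψ ν σ
      · -- the a.e.-constant rational slices accumulate at `τ⁺`: `w τ` is a.e. constant
        push Not at hacc
        obtain ⟨ε, hε, hfar⟩ := hacc
        have hδ : 0 < min ε (-τ) := lt_min hε (by linarith)
        have hr : ∀ n : ℕ, ∃ r : ℚ, τ < r ∧ (r : ℝ) < τ + min ε (-τ) / ((n : ℝ) + 2) := fun n =>
          exists_rat_btwn (lt_add_of_pos_right τ (by positivity))
        choose r hτr hrδ using hr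
        have hr0 : ∀ n, (r n : ℝ) < 0 := by
          intro n
          have h1 : min ε (-τ) / ((n : ℝ) + 2) ≤ min ε (-τ) / 2 :=
            div_le_div_of_nonneg_left hδ.le (by norm_num) (by linarith [(Nat.cast_nonneg n : (0 : ℝ) ≤ n)])
          have h2 : min ε (-τ) ≤ -τ := min_le_right _ _
          linarith [hrδ n]
        have hrε : ∀ n, (r n : ℝ) < τ + ε := by
          intro n
          have h1 : min ε (-τ) / ((n : ℝ) + 2) ≤ min ε (-τ) / 1 :=
            div_le_div_of_nonneg_left hδ.le one_pos (by linarith [(Nat.cast_nonneg n : (0 : ℝ) ≤ n)])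
          have h2 : min ε (-τ) ≤ ε := min_le_left _ _
          linarith [hrδ n]
        have hrconst : ∀ n, ∃ κ : E, u (r n) =ᵐ[volume] fun _ => κ := by
          intro n
          by_contra hne
          push Not at hne
          obtain ⟨j, hj⟩ := hqseq (r n)
          have hqrj : qr j = (r n : ℝ) := by simp only [hqr, hj]
          have hmem : qr j ∈ Hset := ⟨by rw [hqrj]; exact hr0 n, fun κ => by rw [hqrj]; exact hne κ⟩
          have h1 := hfar j hmem (by rw [hqrj]; exact hτr n)
          rw [hqrj] at h1
          linarith [hrε n]
        have hrt : Tendsto (fun n => (r n : ℝ)) atTop (𝓝[Iio 0] τ) := by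
          refine tendsto_nhdsWithin_iff.2 ⟨?_, Eventually.of_forall hr0⟩
          have hup : Tendsto (fun n : ℕ => τ + min ε (-τ) / ((n : ℝ) + 2)) atTop (𝓝 τ) := by
            have h1 : Tendsto (fun n : ℕ => min ε (-τ) / ((n : ℝ) + 2)) atTop (𝓝 0) := by
              have := (tendsto_one_div_add_atTop_nhds_zero_nat.comp (tendsto_add_atTop_nat 1)).const_mul (min ε (-τ))
              rw [mul_zero] at this
              refine this.congr fun n => ?_
              simp only [Function.comp_apply, Nat.cast_add, Nat.cast_one]
              ring
            simpa using h1.const_add τ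
          exact tendsto_of_tendsto_of_tendsto_of_le_of_le tendsto_const_nhds hup (fun n => (hτr n).le) fun n => (hrδ n).le
        have hpair0 : ∀ θ : E → E, FunctionSpaces.IsTestFunctionOn (⊤ : Opens E) θ → VectorCalculus.IsDivFree θ →
            ∫ x, ⟪u τ x, θ x⟫ = 0 := by
          intro θ hθ hdivθ
          have hθ1 : ContDiff ℝ 1 θ := hθ.contDiff.of_le (by exact_mod_cast le_top)
          have hcont := hu.continuousOn_integral_inner hν hmeas hθ hdivθ
          have hlim : Tendsto (fun n => ∫ x, ⟪u (r n) x, θ x⟫) atTop (𝓝 (∫ x, ⟪u τ x, θ x⟫)) :=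
            (hcont τ hτ).tendsto.comp hrt
          have hvals : ∀ n, ∫ x, ⟪u (r n) x, θ x⟫ = 0 := by
            intro n
            obtain ⟨κ, hκ⟩ := hrconst n
            rw [integral_congr_ae (show (fun x => ⟪u (r n) x, θ x⟫) =ᵐ[volume] fun x => ⟪κ, θ x⟫ by
              filter_upwards [hκ] with x hx; rw [hx])]
            exact integral_inner_const_eq_zero_of_isDivFree κ hθ1 hθ.hasCompactSupport hdivθ
          exact tendsto_nhds_unique hlim (tendsto_const_nhds.congr fun n => (hvals n).symm)
        obtain ⟨κ, hκ⟩ := IsWeaklyDivFree.exists_ae_eq_const_of_norm_le_of_forall_integral_inner_eq_zero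
          (hmeas τ hτ) (hM τ hτ) (hu.1.1 τ hτ) hpair0
        -- `w τ = κ - c τ` a.e.
        have hwκ : w τ =ᵐ[volume] fun _ => κ - c τ := by
          filter_upwards [hwu τ hτ, hκ] with x hx hx'
          rw [hx, hx']
        intro ψ hψ σ
        have hψ1 : ContDiff ℝ 1 ψ := hψ.contDiff.of_le (by exact_mod_cast le_top)
        calc ∫ x, ⟪w τ x, fderiv ℝ (heatTest ν ψ σ) x (d τ)⟫
            = ∫ x, ⟪κ - c τ, fderiv ℝ (heatTest ν ψ σ) x (d τ)⟫ :=
              integral_congr_ae (by filter_upwards [hwκ] with x hx; rw [hx])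
          _ = 0 := integral_inner_const_fderiv_heatFlow_eq_zero hψ1 hψ.hasCompactSupport (ν * σ) (κ - c τ) (d τ)
    intro t φ hφ _
    rw [hred φ hφ, hw0 φ hφ]
  -- (ix) the generalised drift lemma: `ũ = u' + d = w + ct` is in the class
  have hsol := hu'sol.add_timeConst_of_ae_orthogonal hu'meas d ⟨M + M, hdb⟩ horth
  have hũ_eq : (fun t x => u' t x + d t) = fun t x => w t x + ct t := by
    funext t x
    simp only [hu'_def, hd_def]
    abel
  rw [hũ_eq] at hsol
  refine ⟨fun t x => w t x + ct t, d, hsol, ?_, ⟨M + M, hdb⟩, fun t ht => ?_⟩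
  · exact hw.add ((hctm.comp measurable_fst).stronglyMeasurable)
  · filter_upwards [hwu t ht] with x hx
    show w t x + ct t = u t x + (ct t - c t)
    rw [hx]
    abel

/-- **Gauge fixing, weak form**: every bounded ancient mild solution in duality form (`0 < ν`) with
a.e.-strongly measurable slices agrees slice-wise a.e., modulo bounded spatial constants, with a
bounded weak solution of Navier–Stokes on `E × (−∞, 0)` in the sense of KNSS 2009, §4 (ii)
(`IsBoundedWeakNSSolutionOn`, a jointly measurable bounded field), which is moreover in the
duality-form class. [cite: KochNadirashviliSereginSverak2009, §4 (i)–(ii) p. 8 with §1 p. 3 (bounded weak solutions and the parasitic drift)] -/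
theorem IsBoundedAncientMildSolution.exists_isBoundedWeakNSSolutionOn_gauge
    (hu : IsBoundedAncientMildSolution ν u) (hν : 0 < ν)
    (hmeas : ∀ t < 0, AEStronglyMeasurable (u t) volume) :
    ∃ (ũ : ℝ → E → E) (d : ℝ → E),
      IsBoundedWeakNSSolutionOn (Iio 0) isOpen_Iio ν ũ ∧ IsBoundedAncientMildSolution ν ũ ∧
      StronglyMeasurable (uncurry ũ) ∧ (∃ D : ℝ, ∀ t < 0, ‖d t‖ ≤ D) ∧
      ∀ t < 0, ũ t =ᵐ[volume] fun x => u t x + d t := by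
  obtain ⟨ũ, d, hsol, hjoint, hd, hslice⟩ := hu.exists_stronglyMeasurable_gauge hν hmeas
  have hsl : ∀ t < 0, AEStronglyMeasurable (ũ t) volume := fun t _ =>
    (hjoint.comp_measurable measurable_prodMk_left).aestronglyMeasurable
  exact ⟨ũ, d, hsol.isBoundedWeakNSSolutionOn hν hjoint.aestronglyMeasurable hsl, hsol, hjoint, hd, hslice⟩

/-- **The slice-wise Liouville statement for the duality-form class is equivalent to the same
statement for its jointly measurable members** (any finite dimension, any `ν > 0`): the tree's
rendering of the Liouville conjecture (L) of KNSS 2009 over families with measurable slices is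
exactly as strong as (L) for the jointly measurable — i.e. print's `L^∞(E × (−∞, 0))` — bounded
ancient mild solutions (gauge fixing moves `u` into that class modulo spatial constants, which the
conclusion does not see). [cite: KochNadirashviliSereginSverak2009, §1 p. 3 (the conjecture (L) for bounded mild ancient solutions; parasitic solutions)] -/
theorem liouville_duality_iff_stronglyMeasurable (hν : 0 < ν) :
    (∀ u : ℝ → E → E, IsBoundedAncientMildSolution ν u →
      (∀ t < 0, AEStronglyMeasurable (u t) volume) →
        ∀ t < 0, ∃ b : E, u t =ᵐ[volume] fun _ => b) ↔
    (∀ u : ℝ → E → E, IsBoundedAncientMildSolution ν u → StronglyMeasurable (uncurry u) →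
        ∀ t < 0, ∃ b : E, u t =ᵐ[volume] fun _ => b) := by
  constructor
  · intro h u hu hjoint
    exact h u hu fun t _ => (hjoint.comp_measurable measurable_prodMk_left).aestronglyMeasurable
  · intro h u hu hmeas t ht
    obtain ⟨ũ, d, hsol, hjoint, -, hslice⟩ := hu.exists_stronglyMeasurable_gauge hν hmeas
    obtain ⟨b, hb⟩ := h ũ hsol hjoint t ht
    refine ⟨b - d t, ?_⟩
    filter_upwards [hslice t ht, hb] with x hx hx'
    have : u t x = ũ t x - d t := by rw [hx]; abel
    rw [this, hx']

end Gauge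

end Literature.Analysis.FluidPDE
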